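import Mathlib.Analysis.InnerProductSpace.Adjoint
import Mathlib.Analysis.CStarAlgebra.Basic
import Mathlib.Analysis.SpecialFunctions.Pow.Real
import HarnessLib

/-!
# The numerical radius of a square-zero operator is at most half its norm

Topic `Literature/Analysis/OperatorTheory`. Theorems only (no definition, no named fact).

**Theorem (Haagerup–de la Harpe 1992, Thm. 1; restated as Wu 1997, Prop. 2.1).** If `T` is a bounded
operator on a complex Hilbert space with `Tⁿ = 0` (`n ≥ 2`), then its numerical range is contained in
the closed disc of radius `‖T‖ · cos(π/(n+1))`; i.e. `w(T) ≤ ‖T‖ cos(π/(n+1))`.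

This file proves the case `n = 2` (`cos(π/3) = 1/2`), in three forms, by an elementary C⋆-identity
argument (not the dilation proof of the sources):

* `norm_add_star_le_of_mul_self_eq_zero` (C⋆-form): in any C⋆-ring, `x * x = 0 → ‖x + x⋆‖ ≤ ‖x‖`.
  Proof: `s = x + x⋆` is self-adjoint with `s² = x x⋆ + x⋆ x`, a sum of two self-adjoint elements
  `a = x x⋆`, `b = x⋆ x` with `a b = b a = 0` and `‖a‖ = ‖b‖ = ‖x‖²`; for such a pair
  `(a + b)^{2^k} = a^{2^k} + b^{2^k}`, so `‖a + b‖^{2^k} ≤ 2 max(‖a‖, ‖b‖)^{2^k}` for every `k`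
  (`‖y^{2^k}‖ = ‖y‖^{2^k}` for self-adjoint `y`, Mathlib `IsSelfAdjoint.norm_pow_two_pow`), whence
  `‖a + b‖ ≤ max(‖a‖, ‖b‖)` (private helper `norm_add_le_max_of_mul_eq_zero`) and `‖s‖² = ‖s²‖ ≤ ‖x‖²`.
* `norm_apply_le_half_of_mul_self_eq_zero` (state form): for a `ℂ`-linear functional `φ` on a
  C⋆-algebra with `‖φ a‖ ≤ C ‖a‖` and `φ(a⋆) = conj (φ a)` (e.g. a state, `C = 1`), `x * x = 0`
  implies `‖φ x‖ ≤ C ‖x‖ / 2` (rotate `x` by a unit scalar so that `φ x ≥ 0`, then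
  `2 φ x = φ(x + x⋆) ≤ C ‖x + x⋆‖ ≤ C ‖x‖`).
* `norm_inner_le_half_norm_of_mul_self_eq_zero` (Hilbert-space form, def-free as in
  `Literature/Analysis/InnerProduct/NumericalRadiusPower.lean`): for `T : E →L[ℂ] E` on a complex
  Hilbert space with `T * T = 0`, `‖⟪x, T x⟫‖ ≤ (‖T‖ / 2) ‖x‖²` for every `x`, i.e. `w(T) ≤ ‖T‖/2`.

The constant `1/2` is sharp (the `2 × 2` Jordan block), loc. cit. Use in this tree: a fermionic
monomial `c†_A c_B` in which some mode occurs only daggered or only undaggered squares to zero, so its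
expectation in ANY state is bounded by half its norm (box `|ω(w)| ≤ ½` for `‖w‖ ≤ 1`).

Mathlib (this pin) has no numerical range / numerical radius (`lean search
'numericalRadius|numerical_radius|NumericalRange'`: only the tree file `NumericalRadiusPower.lean`,
which proves the power inequality and `‖T‖ ≤ 2 w(T)` but nothing on nilpotents).

## References

* [HaagerupDeLaHarpe1992] U. Haagerup, P. de la Harpe, *The numerical radius of a nilpotent operator
  on a Hilbert space*, Proc. Amer. Math. Soc. 115 (1992), no. 2, 371–379, Theorem 1.
* [Wu1997UnitaryDilations] P. Y. Wu, *Unitary dilations and numerical ranges*, J. Operator Theory 38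
  (1997), no. 1, 3–24, Prop. 2.1 ("If `T` is a nilpotent operator with `Tⁿ = 0`, then `W(T)` is
  contained in the closed disc `{z : |z| ≤ ‖T‖ · cos(π/(n+1))}`"; "This proposition was also proved
  in [5], Theorem 1 using more down-to-earth arguments", `[5]` = Haagerup–de la Harpe) — the
  secondary source READ for this file (theta.ro JOT archive 1997-038-001-003).
-/

noncomputable section

namespace Literature.Analysis.OperatorTheory

/-! ## C⋆-form -/

section CStar

variable {A : Type*} [NormedRing A] [StarRing A] [CStarRing A]

omit [StarRing A] [CStarRing A] in
/-- Powers of a sum of two mutually annihilating elements: `a b = b a = 0` implies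
`(a + b)ⁿ = aⁿ + bⁿ` for `n ≥ 1`. [folklore] -/
private theorem add_pow_eq_of_mul_eq_zero {a b : A} (hab : a * b = 0) (hba : b * a = 0) :
    ∀ n : ℕ, 1 ≤ n → (a + b) ^ n = a ^ n + b ^ n := by
  intro n hn
  induction n with
  | zero => exact absurd hn (by norm_num)
  | succ m ih =>
    rcases Nat.eq_zero_or_pos m with rfl | hm
    · simp
    · have h1 : a ^ m * b = 0 := by
        obtain ⟨k, rfl⟩ := Nat.exists_eq_succ_of_ne_zero hm.ne'
        rw [pow_succ, mul_assoc, hab, mul_zero]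
      have h2 : b ^ m * a = 0 := by
        obtain ⟨k, rfl⟩ := Nat.exists_eq_succ_of_ne_zero hm.ne'
        rw [pow_succ, mul_assoc, hba, mul_zero]
      rw [pow_succ, ih hm, add_mul, mul_add, mul_add, h1, h2, add_zero, zero_add, ← pow_succ,
        ← pow_succ]

/-- **Two mutually annihilating self-adjoint elements of a C⋆-ring have `‖a + b‖ ≤ max(‖a‖, ‖b‖)`**
(`a b = b a = 0`; "orthogonal supports"). Proof: `‖a + b‖^{2^k} = ‖(a + b)^{2^k}‖ =
‖a^{2^k} + b^{2^k}‖ ≤ 2 max(‖a‖, ‖b‖)^{2^k}` for every `k`, then `k → ∞`. [folklore] -/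
private theorem norm_add_le_max_of_mul_eq_zero {a b : A} (ha : IsSelfAdjoint a) (hb : IsSelfAdjoint b)
    (hab : a * b = 0) (hba : b * a = 0) : ‖a + b‖ ≤ max ‖a‖ ‖b‖ := by
  set M := max ‖a‖ ‖b‖ with hM
  have hM0 : 0 ≤ M := le_max_of_le_left (norm_nonneg a)
  have hsa : IsSelfAdjoint (a + b) := ha.add hb
  -- the estimate along powers of two
  have hpow : ∀ k : ℕ, ‖a + b‖ ^ (2 ^ k) ≤ 2 * M ^ (2 ^ k) := by
    intro k
    rw [← hsa.norm_pow_two_pow, add_pow_eq_of_mul_eq_zero hab hba (2 ^ k) Nat.one_le_two_pow]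
    calc ‖a ^ 2 ^ k + b ^ 2 ^ k‖ ≤ ‖a ^ 2 ^ k‖ + ‖b ^ 2 ^ k‖ := norm_add_le _ _
      _ = ‖a‖ ^ 2 ^ k + ‖b‖ ^ 2 ^ k := by rw [ha.norm_pow_two_pow, hb.norm_pow_two_pow]
      _ ≤ M ^ 2 ^ k + M ^ 2 ^ k :=
          add_le_add (pow_le_pow_left₀ (norm_nonneg _) (le_max_left _ _) _)
            (pow_le_pow_left₀ (norm_nonneg _) (le_max_right _ _) _)
      _ = 2 * M ^ 2 ^ k := by ring
  -- conclude by letting `k → ∞`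
  by_contra hlt
  rw [not_le] at hlt
  rcases hM0.eq_or_lt with hM0' | hMpos
  · -- `M = 0`: `k = 0` already gives `‖a + b‖ ≤ 0`
    have h := hpow 0
    simp only [pow_zero, pow_one] at h
    linarith
  · -- `M > 0`: the ratio `‖a + b‖ / M > 1` would have bounded powers
    set r : ℝ := ‖a + b‖ / M with hr
    have hr1 : 1 < r := by rw [hr, one_lt_div hMpos]; exact hlt
    have hbound : ∀ k : ℕ, r ^ (2 ^ k) ≤ 2 := by
      intro k
      rw [hr, div_pow, div_le_iff₀ (pow_pos hMpos _)]
      exact hpow k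
    obtain ⟨n, hn⟩ := Filter.eventually_atTop.1
      ((tendsto_pow_atTop_atTop_of_one_lt hr1).eventually_gt_atTop (2 : ℝ))
    exact (not_lt.2 (hbound n)) (hn (2 ^ n) (Nat.lt_two_pow_self).le)

/-- **Haagerup–de la Harpe for `n = 2`, C⋆-form: `x² = 0 ⇒ ‖x + x⋆‖ ≤ ‖x‖`** (equivalently
`‖Re x‖ ≤ ‖x‖/2`) in any C⋆-ring. Proof: `s = x + x⋆` is self-adjoint, `s² = x x⋆ + x⋆ x` with
`(x x⋆)(x⋆ x) = (x⋆ x)(x x⋆) = 0` and `‖x x⋆‖ = ‖x⋆ x‖ = ‖x‖²`, so `‖s‖² = ‖s²‖ ≤ ‖x‖²`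
(`norm_add_le_max_of_mul_eq_zero`).
[cite: HaagerupDeLaHarpe1992, Theorem 1 (case n = 2)] [cite: Wu1997UnitaryDilations, Prop. 2.1] -/
theorem norm_add_star_le_of_mul_self_eq_zero {x : A} (hx : x * x = 0) : ‖x + star x‖ ≤ ‖x‖ := by
  have hxs : star x * star x = 0 := by rw [← star_mul, hx, star_zero]
  have hsa : IsSelfAdjoint (x + star x) := by
    unfold IsSelfAdjoint
    rw [star_add, star_star, add_comm]
  have hsq : (x + star x) * (x + star x) = x * star x + star x * x := by
    rw [add_mul, mul_add, mul_add, hx, hxs, zero_add, add_zero]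
  have ha : IsSelfAdjoint (x * star x) := IsSelfAdjoint.mul_star_self x
  have hb : IsSelfAdjoint (star x * x) := IsSelfAdjoint.star_mul_self x
  have hab : x * star x * (star x * x) = 0 := by
    rw [mul_assoc, ← mul_assoc (star x), hxs, zero_mul, mul_zero]
  have hba : star x * x * (x * star x) = 0 := by
    rw [mul_assoc, ← mul_assoc x, hx, zero_mul, mul_zero]
  have h2 : ‖x + star x‖ ^ 2 ≤ ‖x‖ ^ 2 := by
    calc ‖x + star x‖ ^ 2 = ‖(x + star x) * (x + star x)‖ := by
          rw [sq, ← CStarRing.norm_star_mul_self, hsa.star_eq]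
      _ = ‖x * star x + star x * x‖ := by rw [hsq]
      _ ≤ max ‖x * star x‖ ‖star x * x‖ := norm_add_le_max_of_mul_eq_zero ha hb hab hba
      _ = ‖x‖ ^ 2 := by
          rw [CStarRing.norm_self_mul_star, CStarRing.norm_star_mul_self, max_self, sq]
  exact le_of_pow_le_pow_left₀ two_ne_zero (norm_nonneg x) h2

variable [NormedAlgebra ℂ A]

/-- A unit-scalar rotation of a square-zero element is square-zero with the same norm, so
`‖c • x + (c • x)⋆‖ ≤ ‖x‖` for `‖c‖ ≤ 1`. [cite: HaagerupDeLaHarpe1992, Theorem 1 (case n = 2)] -/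
theorem norm_smul_add_star_smul_le_of_mul_self_eq_zero {x : A} (hx : x * x = 0) {c : ℂ}
    (hc : ‖c‖ ≤ 1) : ‖c • x + star (c • x)‖ ≤ ‖x‖ := by
  have hy : (c • x) * (c • x) = 0 := by
    rw [smul_mul_assoc, mul_smul_comm, hx, smul_zero, smul_zero]
  calc ‖c • x + star (c • x)‖ ≤ ‖c • x‖ := norm_add_star_le_of_mul_self_eq_zero hy
    _ = ‖c‖ * ‖x‖ := norm_smul c x
    _ ≤ 1 * ‖x‖ := mul_le_mul_of_nonneg_right hc (norm_nonneg x)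
    _ = ‖x‖ := one_mul _

/-- **State form: `x² = 0 ⇒ |φ(x)| ≤ C ‖x‖ / 2`** for every Hermitian `ℂ`-linear functional `φ`
with `‖φ a‖ ≤ C ‖a‖` (a state of a unital C⋆-algebra: `C = 1`). Proof: choose a unit scalar `c`
with `c φ(x) = |φ(x)|` and put `y = c • x` (`y² = 0`, `‖y‖ = ‖x‖`); then
`2 |φ(x)| = φ(y) + φ(y⋆) = φ(y + y⋆) ≤ C ‖y + y⋆‖ ≤ C ‖x‖`. This is the numerical-radius
statement `w(x) ≤ ‖x‖/2` read through the state space.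
[cite: HaagerupDeLaHarpe1992, Theorem 1 (case n = 2)] [cite: Wu1997UnitaryDilations, Prop. 2.1] -/
theorem norm_apply_le_half_of_mul_self_eq_zero (φ : A →ₗ[ℂ] ℂ) {C : ℝ} (hC : 0 ≤ C)
    (hφ : ∀ a, ‖φ a‖ ≤ C * ‖a‖) (hφs : ∀ a, φ (star a) = star (φ a)) {x : A} (hx : x * x = 0) :
    ‖φ x‖ ≤ C * ‖x‖ / 2 := by
  by_cases h0 : φ x = 0
  · rw [h0, norm_zero]
    positivity
  have hnpos : 0 < ‖φ x‖ := norm_pos_iff.2 h0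
  have hne : (‖φ x‖ : ℂ) ≠ 0 := by exact_mod_cast hnpos.ne'
  -- the rotating scalar
  set c : ℂ := star (φ x) / (‖φ x‖ : ℂ) with hc
  have hcn : ‖c‖ ≤ 1 := by
    rw [hc, norm_div, norm_star, Complex.norm_real, Real.norm_of_nonneg hnpos.le, div_self hnpos.ne']
  have hcx : c * φ x = (‖φ x‖ : ℂ) := by
    rw [hc, div_mul_eq_mul_div, Complex.star_def, Complex.conj_mul', sq, mul_div_assoc,
      div_self hne, mul_one]
  -- the rotated element
  set y : A := c • x with hy
  have hφy : φ y = (‖φ x‖ : ℂ) := by rw [hy, map_smul, smul_eq_mul, hcx]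
  have hφsy : φ (star y) = (‖φ x‖ : ℂ) := by
    rw [hφs, hφy, Complex.star_def, Complex.conj_ofReal]
  have hsum : φ (y + star y) = 2 * (‖φ x‖ : ℂ) := by
    rw [map_add, hφy, hφsy]
    ring
  have key : 2 * ‖φ x‖ ≤ C * ‖x‖ := by
    calc 2 * ‖φ x‖ = ‖φ (y + star y)‖ := by
          rw [hsum, norm_mul, Complex.norm_real, Real.norm_of_nonneg hnpos.le, RCLike.norm_ofNat]
      _ ≤ C * ‖y + star y‖ := hφ _
      _ ≤ C * ‖x‖ :=
          mul_le_mul_of_nonneg_left (norm_smul_add_star_smul_le_of_mul_self_eq_zero hx hcn) hC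
  linarith

/-- State form with a norm bound on the element: `x² = 0`, `‖x‖ ≤ R` ⇒ `|φ(x)| ≤ C R / 2`
(the box `|ω(w)| ≤ ½` for a square-zero contraction `w` in a state `ω`).
[cite: HaagerupDeLaHarpe1992, Theorem 1 (case n = 2)] -/
theorem norm_apply_le_half_of_mul_self_eq_zero_of_norm_le (φ : A →ₗ[ℂ] ℂ) {C : ℝ} (hC : 0 ≤ C)
    (hφ : ∀ a, ‖φ a‖ ≤ C * ‖a‖) (hφs : ∀ a, φ (star a) = star (φ a)) {x : A} (hx : x * x = 0)
    {R : ℝ} (hR : ‖x‖ ≤ R) : ‖φ x‖ ≤ C * R / 2 :=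
  (norm_apply_le_half_of_mul_self_eq_zero φ hC hφ hφs hx).trans
    (by gcongr)

end CStar

/-! ## Hilbert-space form -/

section Hilbert

open scoped InnerProductSpace

variable {E : Type*} [NormedAddCommGroup E] [InnerProductSpace ℂ E] [CompleteSpace E]

/-- **Haagerup–de la Harpe, `n = 2`: a bounded operator `T` on a complex Hilbert space with
`T² = 0` has numerical radius `w(T) ≤ ‖T‖/2`**, i.e. `|⟪x, T x⟫| ≤ (‖T‖/2) ‖x‖²` for every `x`
(def-free form). From the state form applied to the vector functional `S ↦ ⟪x, S x⟫`
(`|⟪x, S x⟫| ≤ ‖x‖² ‖S‖`, `⟪x, S⋆ x⟫ = conj ⟪x, S x⟫`).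
[cite: HaagerupDeLaHarpe1992, Theorem 1 (case n = 2)] [cite: Wu1997UnitaryDilations, Prop. 2.1] -/
theorem norm_inner_le_half_norm_of_mul_self_eq_zero (T : E →L[ℂ] E) (hT : T * T = 0) (x : E) :
    ‖⟪x, T x⟫_ℂ‖ ≤ ‖T‖ / 2 * ‖x‖ ^ 2 := by
  -- the vector functional `S ↦ ⟪x, S x⟫`
  let φ : (E →L[ℂ] E) →ₗ[ℂ] ℂ :=
    { toFun := fun S => ⟪x, S x⟫_ℂ
      map_add' := fun S₁ S₂ => inner_add_right x (S₁ x) (S₂ x)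
      map_smul' := fun c S => by simpa using inner_smul_right x (S x) c }
  have hφ : ∀ S : E →L[ℂ] E, ‖φ S‖ ≤ ‖x‖ ^ 2 * ‖S‖ := fun S => by
    calc ‖⟪x, S x⟫_ℂ‖ ≤ ‖x‖ * ‖S x‖ := norm_inner_le_norm _ _
      _ ≤ ‖x‖ * (‖S‖ * ‖x‖) := mul_le_mul_of_nonneg_left (S.le_opNorm x) (norm_nonneg _)
      _ = ‖x‖ ^ 2 * ‖S‖ := by ring
  have hφs : ∀ S : E →L[ℂ] E, φ (star S) = star (φ S) := fun S => by
    show ⟪x, (star S) x⟫_ℂ = star ⟪x, S x⟫_ℂ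
    rw [ContinuousLinearMap.star_eq_adjoint, ContinuousLinearMap.adjoint_inner_right,
      Complex.star_def]
    exact (inner_conj_symm _ _).symm
  have h := norm_apply_le_half_of_mul_self_eq_zero φ (sq_nonneg ‖x‖) hφ hφs hT
  calc ‖⟪x, T x⟫_ℂ‖ = ‖φ T‖ := rfl
    _ ≤ ‖x‖ ^ 2 * ‖T‖ / 2 := h
    _ = ‖T‖ / 2 * ‖x‖ ^ 2 := by ring

/-- Unit-vector form: `T² = 0`, `‖x‖ = 1` ⇒ `|⟪x, T x⟫| ≤ ‖T‖/2`.
[cite: HaagerupDeLaHarpe1992, Theorem 1 (case n = 2)] -/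
theorem norm_inner_le_half_norm_of_mul_self_eq_zero_of_norm_eq_one (T : E →L[ℂ] E)
    (hT : T * T = 0) {x : E} (hx : ‖x‖ = 1) : ‖⟪x, T x⟫_ℂ‖ ≤ ‖T‖ / 2 := by
  simpa [hx] using norm_inner_le_half_norm_of_mul_self_eq_zero T hT x

end Hilbert

end Literature.Analysis.OperatorTheory
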